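import Summits.QuantumFields.BalabanUV.Beta.EriceFlowEnclosureB12AsPrintedHistoryContagionShiftFlowPicardPin

/-!
# Beta / EriceFlowEnclosureB12AsPrintedHistoryContagionShiftFlowPicardFunctional — ASYMPTOTIC FREEDOM IS CONTAGIOUS, part 16: LIPSCHITZ DEPENDENCE ON THE
# FUNCTIONAL, FLOOR-FREE.  Node U2's well-posedness (`T4BetaFlowWellPosed` §4) has three legs — existence ∕ uniqueness, Lipschitz dependence on the infrared datum, and
# Lipschitz dependence on the FUNCTIONAL (`memFlow_stability ∕ memFlow_lipschitz_functional`: two functionals η-close on the box have solutions `(γ∕b)η∕(1−q)`-close) — all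
# under the floor `b ≤ B` and `C_m γ < b(1 − θ)`.  Parts 10 ∕ 12–14 did the first two legs floor-free near zero pin; this part does the third: `B` with memory profile
# `(C_m, θ)`, ANY functional `B′` with `|B − B′| ≤ η` on the box (no profile, no floor asked of B′), two box solutions h of `(B, e)` and h′ of `(B′, e)` carrying the quarter
# profile from 2f (parts 10 ∕ 13 supply it from ONE asymptotically free reference) ⟹ **`|1∕h(m)² − 1∕h′(m)²| ≤ (4∕3)·η·(m+1)`** and, in the couplings, **`|h(m) − h′(m)| ≤
# (32∕3)·f·(f² + 1∕β*)·η` UNIFORMLY IN THE SCALE** under `C_m(8f³ + 16f∕β*) ≤ (1 − θ)²∕4` — the asymptotic-freedom weight `h²h′ ≲ f∕(β* m)` absorbing the linear growth of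
# the chart separation exactly as node U2's `mul_one_div_base_le` did with the floor.  Abstract in B; part 17 reads it on the as-printed carrier for two limit functionals
# (β-flow team, prover 1, unit `b2b-balaban-beta-bflow-p1`, gen 37; ROW AP-I·Uc × NODE U2)

HONEST FRAMING (page 1 of everything the β sub-cell writes): discharging `BetaPertH` makes Bałaban's UV stability UNCONDITIONAL — a
real constructive-QFT result; it is NOT the continuum limit and NOT the Clay problem.  HONEST DEPENDENCY (cell reorg 2026-08-19,
verbatim): «continuum YM on T⁴ ⇐ BetaPertH ∧ nine spine estimates (0/9 proved); BetaPertH ⇐ (D1) ∧ (D4) ∧ CAP+tail; G-an2-4 gates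
asym, D1 and NE2/3/4.»  THIS MODULE DISCHARGES NOTHING: [folklore] real analysis (finite sums, the `tsum` `Σ (j+1)θ^j = 1∕(1−θ)²`, node U2's index-free Grönwall closing step
`le_of_affine_contraction` BY NAME) over node U2's HYPOTHESIS SHAPES `T4BetaStationary.{SeqBox, MemoryProfile}`, `T4BetaFlowWellPosed.{MemFlow, drive}` and
`T4CouplingMatching.{prof, sprof, sum_profWeights_le}` on ABSTRACT functionals `B, B′ : (ℕ → ℝ) → ℝ` — the shapes node U2 derives (`memoryProfile_betaInf`, `memFlow_gstar`) from
its NE4 ∕ history-moduli LETTERS (NOT PRINTED for [I] = T. Bałaban, Commun. Math. Phys. **109** (1987) [Balaban1987RG1]: GAPS G-t4-U2-1 ∕ -2; p. 298 says only that β_j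
depends on the preceding couplings); the quarter profile is the shape of (0.31)'s lower half (Theorem 2 p. 259, STATED WITHOUT PROOF) in the continuum.  Nothing of Bałaban's
β is asserted; nothing of node U2's modules is restated or modified.

THE POINT.  With the same pin, `Δ_m = 1∕h(m)² − 1∕h′(m)² = [drive B h m − drive B h′ m] + [drive B h′ m − drive B′ h′ m]`; the second bracket is `≤ η·m`; the first is
part 14's kernel run with the LINEAR weight: if `|Δ_q| ≤ N·(q+1)` then (§19) it is `≤ (C_m∕(1−θ)²)·(8f³ + 16f∕β*)·N·(m+1)` (`|h − h′| ≤ h²h′|Δ|`, the antitone AF weight, and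
`(q+1)θ^j ≤ (m+1)(j+1)θ^j` for q = p+1+j, p < m, summed by `Σ_j (j+1)θ^j = 1∕(1−θ)²`); so `N ↦ η + q₀N`, `q₀ ≤ ¼`, and node U2's `le_of_affine_contraction` closes at
`N ≤ 4η∕3` from the a-priori linear bound (node U2's `abs_drive_sub_drive_le`).  In the couplings the AF weight `h(m)²h′(m) ≤ 2f∕(1∕(4f²) + (β*∕4)m)` kills the factor (m+1).

WHAT THIS FILE PROVES (0 sorry, 0 def): §19 `hasSum_succ_mul_geometric`, **`abs_drive_sub_drive_le_linear`**; §20 **`invSq_sep_le_of_functional_close`**,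
**`abs_sub_le_of_functional_close`** (Lipschitz in the functional, uniformly in the scale), **`abs_solution_sub_le_of_functional_close`** (for node U2's `solution B e`,
`solution B′ e` when BOTH functionals carry a memory profile and an AF reference: the floor-free `memFlow_lipschitz_functional`); §20b **`abs_picardIter_sub_le_uniform`** (the
same kernel along ONE iteration from a profiled start: `|(picard B e)^[n] u₀ − h| ≤ 8e(e² + 1∕β*)N₀·4^{−n}` UNIFORMLY IN THE SCALE — part 13's rate without the weight `(2∕(1+θ))^q`).
NOT CLAIMED: anything about Bałaban's β; existence for a functional without reference; `BetaPertH`; the continuum limit of the measures; Clay.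
-/

namespace Summit.QuantumFields.BalabanUV.Beta.EriceFlowEnclosureB12AsPrintedHistoryContagionShiftFlowPicardFunctional

open Finset Filter Topology
open Literature.MathematicalPhysics.QuantumFieldTheory.Balaban1983to89
open Literature.MathematicalPhysics.QuantumFieldTheory.Balaban1983to89.T4CouplingMatching (prof sprof sprof_pos sprof_sq prof_pos sprof_zero sum_profWeights_le
  abs_sub_le_of_inv_sq)
open Literature.MathematicalPhysics.QuantumFieldTheory.Balaban1983to89.T4BetaStationary (SeqBox MemoryProfile summable_profile abs_sub_le_of_seqBox
  tsum_profile_le)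
open Literature.MathematicalPhysics.QuantumFieldTheory.Balaban1983to89.T4BetaFlowWellPosed (MemFlow drive picard solution seqBox_shift invSq_eq_of_memFlow
  abs_drive_sub_drive_le le_of_affine_contraction)
open Summit.QuantumFields.BalabanUV.Beta.EriceFlowEnclosureB12AsPrintedHistoryContagion (sprof_le_sprof)
open Summit.QuantumFields.BalabanUV.Beta.EriceFlowEnclosureB12AsPrintedHistoryContagionProfile (le_two_mul_of_profile)
open Summit.QuantumFields.BalabanUV.Beta.EriceFlowEnclosureB12AsPrintedHistoryContagionShiftFlow (le_invSprof_of_prof_le)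
open Summit.QuantumFields.BalabanUV.Beta.EriceFlowEnclosureB12AsPrintedHistoryContagionShiftFlowPicard (picardIter_mem picardIter_profile invSq_picardIter_succ)
open Summit.QuantumFields.BalabanUV.Beta.EriceFlowEnclosureB12AsPrintedHistoryContagionShiftFlowPicardLimit (memFlow_solution_of_reference)

noncomputable section

/-! ## §19 The linear-weight kernel -/

/-- `Σ_j (j+1)θ^j = 1∕(1−θ)²` (0 ≤ θ < 1). [folklore] -/
theorem hasSum_succ_mul_geometric {θ : ℝ} (hθ0 : 0 ≤ θ) (hθ1 : θ < 1) :
    HasSum (fun j : ℕ => ((j : ℝ) + 1) * θ ^ j) (1 / (1 - θ) ^ 2) := by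
  have h1θ : (1 - θ) ≠ 0 := by linarith
  have h1 := hasSum_coe_mul_geometric_of_norm_lt_one (𝕜 := ℝ) (r := θ) (by rwa [Real.norm_eq_abs, abs_of_nonneg hθ0])
  have h2 := hasSum_geometric_of_lt_one hθ0 hθ1
  have e1 : (fun j : ℕ => ((j : ℝ) + 1) * θ ^ j) = fun n : ℕ => (n : ℝ) * θ ^ n + θ ^ n := by
    funext j; ring
  have e2 : 1 / (1 - θ) ^ 2 = θ / (1 - θ) ^ 2 + (1 - θ)⁻¹ := by
    field_simp
    ring
  rw [e1, e2]
  exact h1.add h2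

/-- **THE LINEAR-WEIGHT KERNEL.**  `B` with memory profile `(C_m, θ)` on ]0, γ]^ℕ (0 ≤ θ < 1, C_m ≥ 0); two box histories u, u′ both carrying the quarter profile from 2f
(f > 0, β* > 0) whose chart separation grows at most linearly, `|1∕u(q)² − 1∕u′(q)²| ≤ N·(q+1)`.  THEN `|drive B u m − drive B u′ m| ≤ (C_m∕(1−θ)²)·(8f³ + 16f∕β*)·N·(m+1)`
for every m (`|u − u′| ≤ u²u′|Δ|`, the antitone weight `w_q = (1∕(4f²) + (β*∕4)q)^{−3∕2}`, `(q+1)θ^j ≤ (m+1)(j+1)θ^j`, `Σ_j (j+1)θ^j = 1∕(1−θ)²`, `Σ_{q≤m} w_q ≤ 8f³ + 16f∕β*`).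
[cite: Balaban1987RG1, Thm 2 (0.31) p.259 with (0.20) p.256 and p.298] -/
theorem abs_drive_sub_drive_le_linear {B : (ℕ → ℝ) → ℝ} {Cm θ γ bs f N : ℝ} {u u' : ℕ → ℝ}
    (hB : MemoryProfile Cm θ γ B) (hCm : 0 ≤ Cm) (hθ0 : 0 ≤ θ) (hθ1 : θ < 1) (hbs : 0 < bs) (hf : 0 < f)
    (hus : SeqBox γ u) (hus' : SeqBox γ u')
    (hPu : ∀ q : ℕ, 1 / (4 * f ^ 2) + bs / 4 * (q : ℝ) ≤ 1 / (u q) ^ 2)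
    (hPu' : ∀ q : ℕ, 1 / (4 * f ^ 2) + bs / 4 * (q : ℝ) ≤ 1 / (u' q) ^ 2)
    (hN : ∀ q : ℕ, |1 / (u q) ^ 2 - 1 / (u' q) ^ 2| ≤ N * ((q : ℝ) + 1)) (m : ℕ) :
    |drive B u m - drive B u' m| ≤ Cm / (1 - θ) ^ 2 * (8 * f ^ 3 + 16 * f / bs) * N * ((m : ℝ) + 1) := by
  have h1θ : 0 < 1 - θ := by linarith
  have h2f : 0 < 2 * f := by positivity
  have hb4 : 0 < bs / 4 := by positivity
  have hp0 := sprof_pos h2f hb4.le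
  have hN0 : 0 ≤ N := by
    have h := hN 0
    simp only [Nat.cast_zero, zero_add, mul_one] at h
    exact (abs_nonneg _).trans h
  have hm1 : (0 : ℝ) < (m : ℝ) + 1 := by positivity
  have e4 : (2 * f) ^ 2 = 4 * f ^ 2 := by ring
  set w : ℕ → ℝ := fun q => 1 / (sprof (2 * f) (bs / 4) q) ^ 2 * (1 / sprof (2 * f) (bs / 4) q) with hw
  have hw0 : ∀ q, 0 ≤ w q := fun q => by
    have hpq := hp0 q
    show 0 ≤ 1 / (sprof (2 * f) (bs / 4) q) ^ 2 * (1 / sprof (2 * f) (bs / 4) q)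
    positivity
  have hwanti : ∀ {a b : ℕ}, a ≤ b → w b ≤ w a := by
    intro a b hab
    have hpa := hp0 a
    have h1 : 1 / sprof (2 * f) (bs / 4) b ≤ 1 / sprof (2 * f) (bs / 4) a :=
      one_div_le_one_div_of_le (hp0 a) (sprof_le_sprof hb4.le hab)
    have h2 : 1 / (sprof (2 * f) (bs / 4) b) ^ 2 ≤ 1 / (sprof (2 * f) (bs / 4) a) ^ 2 :=
      one_div_le_one_div_of_le (pow_pos (hp0 a) 2) (pow_le_pow_left₀ (hp0 a).le (sprof_le_sprof hb4.le hab) 2)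
    show 1 / (sprof (2 * f) (bs / 4) b) ^ 2 * (1 / sprof (2 * f) (bs / 4) b) ≤ 1 / (sprof (2 * f) (bs / 4) a) ^ 2 * (1 / sprof (2 * f) (bs / 4) a)
    exact mul_le_mul h2 h1 (one_div_pos.mpr (hp0 b)).le (by positivity)
  -- pointwise: |u q − u′ q| ≤ w_q · N (q+1)
  have hpt : ∀ q : ℕ, |u q - u' q| ≤ w q * (N * ((q : ℝ) + 1)) := by
    intro q
    have hq := (hus q).1
    have hq' := (hus' q).1
    have hpq := hp0 q
    have hu1 : u q ≤ 1 / sprof (2 * f) (bs / 4) q := le_invSprof_of_prof_le h2f hb4.le hq (by rw [e4]; exact hPu q)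
    have hu1' : u' q ≤ 1 / sprof (2 * f) (bs / 4) q := le_invSprof_of_prof_le h2f hb4.le hq' (by rw [e4]; exact hPu' q)
    have hsq : (u q) ^ 2 ≤ 1 / (sprof (2 * f) (bs / 4) q) ^ 2 :=
      calc (u q) ^ 2 ≤ (1 / sprof (2 * f) (bs / 4) q) ^ 2 := pow_le_pow_left₀ hq.le hu1 2
        _ = 1 / (sprof (2 * f) (bs / 4) q) ^ 2 := by rw [one_div_pow]
    calc |u q - u' q| ≤ (u q) ^ 2 * u' q * |1 / (u q) ^ 2 - 1 / (u' q) ^ 2| := abs_sub_le_of_inv_sq hq hq'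
      _ ≤ 1 / (sprof (2 * f) (bs / 4) q) ^ 2 * (1 / sprof (2 * f) (bs / 4) q) * (N * ((q : ℝ) + 1)) :=
          mul_le_mul (mul_le_mul hsq hu1' hq'.le (by positivity)) (hN q) (abs_nonneg _) (by positivity)
      _ = w q * (N * ((q : ℝ) + 1)) := by rw [hw]
  have hH := hasSum_succ_mul_geometric hθ0 hθ1
  -- one memory term, p < m
  have hterm : ∀ p : ℕ, p < m →
      |B (fun j => u (p + 1 + j)) - B (fun j => u' (p + 1 + j))| ≤ Cm * (w (p + 1) * N * ((m : ℝ) + 1) * (1 / (1 - θ) ^ 2)) := by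
    intro p hp
    have hpm : (p : ℝ) + 1 ≤ (m : ℝ) := by
      have := Nat.succ_le_of_lt hp
      exact_mod_cast this
    have hs := summable_profile hθ0 hθ1 (seqBox_shift hus (p + 1)) (seqBox_shift hus' (p + 1))
    have hg : Summable fun j : ℕ => (w (p + 1) * N * ((m : ℝ) + 1)) * (((j : ℝ) + 1) * θ ^ j) := hH.summable.mul_left _
    refine (hB _ _ (seqBox_shift hus (p + 1)) (seqBox_shift hus' (p + 1))).trans (mul_le_mul_of_nonneg_left ?_ hCm)
    calc ∑' j, θ ^ j * |u (p + 1 + j) - u' (p + 1 + j)| ≤ ∑' j : ℕ, (w (p + 1) * N * ((m : ℝ) + 1)) * (((j : ℝ) + 1) * θ ^ j) := by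
          refine hs.tsum_le_tsum (fun j => ?_) hg
          have hj0 : (0 : ℝ) ≤ (j : ℝ) := Nat.cast_nonneg j
          have hm0 : (0 : ℝ) ≤ (m : ℝ) := Nat.cast_nonneg m
          have hq1 : ((p + 1 + j : ℕ) : ℝ) + 1 ≤ ((m : ℝ) + 1) * ((j : ℝ) + 1) := by
            push_cast; nlinarith
          have hwq : w (p + 1 + j) ≤ w (p + 1) := hwanti (by omega)
          calc θ ^ j * |u (p + 1 + j) - u' (p + 1 + j)| ≤ θ ^ j * (w (p + 1 + j) * (N * (((p + 1 + j : ℕ) : ℝ) + 1))) :=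
                mul_le_mul_of_nonneg_left (hpt _) (pow_nonneg hθ0 j)
            _ ≤ θ ^ j * (w (p + 1) * (N * (((m : ℝ) + 1) * ((j : ℝ) + 1)))) := by
                refine mul_le_mul_of_nonneg_left ?_ (pow_nonneg hθ0 j)
                exact mul_le_mul hwq (mul_le_mul_of_nonneg_left hq1 hN0) (by positivity) (hw0 _)
            _ = (w (p + 1) * N * ((m : ℝ) + 1)) * (((j : ℝ) + 1) * θ ^ j) := by ring
      _ = (w (p + 1) * N * ((m : ℝ) + 1)) * (1 / (1 - θ) ^ 2) := by rw [tsum_mul_left, hH.tsum_eq]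
  -- the weight sum
  have hW : ∑ p ∈ range m, w (p + 1) ≤ 8 * f ^ 3 + 16 * f / bs := by
    have h1 : ∑ p ∈ range m, w (p + 1) ≤ ∑ q ∈ range (m + 1), w q := by
      rw [Finset.sum_range_succ']; linarith [hw0 0]
    have h2 : ∑ q ∈ range (m + 1), w q = ∑ i ∈ range (m + 1), w (m - i) := by
      rw [← Finset.sum_range_reflect w (m + 1)]
      exact Finset.sum_congr rfl fun i _ => congrArg w (by omega)
    have h3 : ∑ i ∈ range (m + 1), 1 / (sprof (2 * f) (bs / 4) (m - i)) ^ 2 * (1 / sprof (2 * f) (bs / 4) (m - i))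
        ≤ (2 * f) ^ 3 + 2 * (2 * f) / (bs / 4) := sum_profWeights_le h2f hb4 m
    have h4 : (2 * f) ^ 3 + 2 * (2 * f) / (bs / 4) = 8 * f ^ 3 + 16 * f / bs := by
      field_simp
      ring
    calc ∑ p ∈ range m, w (p + 1) ≤ ∑ q ∈ range (m + 1), w q := h1
      _ = ∑ i ∈ range (m + 1), w (m - i) := h2
      _ ≤ (2 * f) ^ 3 + 2 * (2 * f) / (bs / 4) := h3
      _ = 8 * f ^ 3 + 16 * f / bs := h4
  unfold T4BetaFlowWellPosed.drive
  rw [← Finset.sum_sub_distrib]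
  calc |∑ p ∈ range m, (B (fun j => u (p + 1 + j)) - B (fun j => u' (p + 1 + j)))|
      ≤ ∑ p ∈ range m, |B (fun j => u (p + 1 + j)) - B (fun j => u' (p + 1 + j))| := Finset.abs_sum_le_sum_abs _ _
    _ ≤ ∑ p ∈ range m, Cm * (w (p + 1) * N * ((m : ℝ) + 1) * (1 / (1 - θ) ^ 2)) :=
        Finset.sum_le_sum fun p hp => hterm p (mem_range.mp hp)
    _ = Cm / (1 - θ) ^ 2 * N * ((m : ℝ) + 1) * ∑ p ∈ range m, w (p + 1) := by
        rw [Finset.mul_sum]; refine Finset.sum_congr rfl fun p _ => ?_; field_simp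
    _ ≤ Cm / (1 - θ) ^ 2 * N * ((m : ℝ) + 1) * (8 * f ^ 3 + 16 * f / bs) := mul_le_mul_of_nonneg_left hW (by positivity)
    _ = Cm / (1 - θ) ^ 2 * (8 * f ^ 3 + 16 * f / bs) * N * ((m : ℝ) + 1) := by ring

/-! ## §20 Lipschitz dependence on the functional, floor-free -/

/-- **THE CHART SEPARATION OF THE SOLUTIONS OF TWO η-CLOSE FUNCTIONALS GROWS AT MOST LIKE (4∕3)η·(m+1).**  `B` with memory profile `MemoryProfile C_m θ γ B`; ANY `B′` with
`|B u − B′ u| ≤ η` on the box; box solutions h of `MemFlow B e h` and h′ of `MemFlow B′ e h′` (SAME pin) both carrying the quarter profile from 2f (`1∕(4f²) + (β*∕4)q ≤ 1∕h², 1∕h′²`);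
smallness `C_m(8f³ + 16f∕β*) ≤ (1 − θ)²∕4`.  THEN `|1∕h(m)² − 1∕h′(m)²| ≤ (4∕3)·η·(m+1)` for all m (node U2's `le_of_affine_contraction` on `δ_m = |Δ_m|∕(m+1)` with A = η,
q₀ ≤ ¼, from the a-priori bound `δ ≤ C_mγ∕(1−θ) + η`). [cite: Balaban1987RG1, Thm 2 (0.31) p.259 with (0.20) p.256 and p.298] -/
theorem invSq_sep_le_of_functional_close {B B' : (ℕ → ℝ) → ℝ} {Cm θ γ bs f η e : ℝ} {h h' : ℕ → ℝ}
    (hB : MemoryProfile Cm θ γ B) (hCm : 0 ≤ Cm) (hθ0 : 0 ≤ θ) (hθ1 : θ < 1) (hbs : 0 < bs) (hf : 0 < f)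
    (hη : ∀ u, SeqBox γ u → |B u - B' u| ≤ η)
    (hhs : SeqBox γ h) (hhs' : SeqBox γ h') (hhf : MemFlow B e h) (hhf' : MemFlow B' e h')
    (hPh : ∀ q : ℕ, 1 / (4 * f ^ 2) + bs / 4 * (q : ℝ) ≤ 1 / (h q) ^ 2)
    (hPh' : ∀ q : ℕ, 1 / (4 * f ^ 2) + bs / 4 * (q : ℝ) ≤ 1 / (h' q) ^ 2)
    (hs6 : Cm * (8 * f ^ 3 + 16 * f / bs) ≤ (1 - θ) ^ 2 / 4) (m : ℕ) :
    |1 / (h m) ^ 2 - 1 / (h' m) ^ 2| ≤ 4 / 3 * η * ((m : ℝ) + 1) := by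
  have h1θ : 0 < 1 - θ := by linarith
  have hγ : 0 ≤ γ := (hhs 0).1.le.trans (hhs 0).2
  have hη0 : 0 ≤ η := (abs_nonneg _).trans (hη h hhs)
  have hΔ : ∀ q : ℕ, 1 / (h q) ^ 2 - 1 / (h' q) ^ 2 = drive B h q - drive B' h' q := fun q => by
    rw [invSq_eq_of_memFlow hhf q, invSq_eq_of_memFlow hhf' q]; ring
  set q₀ : ℝ := Cm / (1 - θ) ^ 2 * (8 * f ^ 3 + 16 * f / bs) with hq₀
  have hq00 : 0 ≤ q₀ := by positivity
  have hq01 : q₀ ≤ 1 / 4 := by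
    rw [hq₀, div_mul_eq_mul_div, div_le_iff₀ (by positivity)]; linarith
  -- a priori: δ_i ≤ C_mγ∕(1−θ) + η
  have h0 : ∀ i : ℕ, |1 / (h i) ^ 2 - 1 / (h' i) ^ 2| / ((i : ℝ) + 1) ≤ Cm * (γ / (1 - θ)) + η := by
    intro i
    rw [hΔ i, div_le_iff₀ (by positivity)]
    have h1 := abs_drive_sub_drive_le hB hCm hθ0 hθ1 hη hhs hhs' (D := γ) (fun j => abs_sub_le_of_seqBox hhs hhs' j) i
    have hK : 0 ≤ Cm * (γ / (1 - θ)) + η := by positivity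
    nlinarith
  -- the improving step
  have hstep : ∀ D : ℝ, (∀ i : ℕ, |1 / (h i) ^ 2 - 1 / (h' i) ^ 2| / ((i : ℝ) + 1) ≤ D) →
      ∀ i : ℕ, |1 / (h i) ^ 2 - 1 / (h' i) ^ 2| / ((i : ℝ) + 1) ≤ η + q₀ * D := by
    intro D hD i
    have hN : ∀ q : ℕ, |1 / (h q) ^ 2 - 1 / (h' q) ^ 2| ≤ D * ((q : ℝ) + 1) := fun q =>
      (div_le_iff₀ (by positivity)).mp (hD q)
    have h1 := abs_drive_sub_drive_le_linear hB hCm hθ0 hθ1 hbs hf hhs hhs' hPh hPh' hN i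
    have h2 := abs_drive_sub_drive_le hB hCm hθ0 hθ1 hη hhs' hhs' (D := 0) (fun j => by simp) i
    simp only [zero_div, mul_zero, zero_add] at h2
    rw [hΔ i, div_le_iff₀ (by positivity)]
    have htri : |drive B h i - drive B' h' i| ≤ |drive B h i - drive B h' i| + |drive B h' i - drive B' h' i| := abs_sub_le _ _ _
    have hi0 : (0 : ℝ) ≤ (i : ℝ) := Nat.cast_nonneg i
    have hD0 : 0 ≤ D := by
      have := hD 0
      simp only [Nat.cast_zero, zero_add, div_one] at this
      exact (abs_nonneg _).trans this
    nlinarith [mul_nonneg hη0 hi0, mul_nonneg hq00 hD0]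
  have hmain := le_of_affine_contraction hq00 (by linarith : q₀ < 1) hη0 h0 hstep m
  rw [div_le_iff₀ (by positivity)] at hmain
  have hcoef : η / (1 - q₀) ≤ 4 / 3 * η := by
    rw [div_le_iff₀ (by linarith)]; nlinarith
  calc |1 / (h m) ^ 2 - 1 / (h' m) ^ 2| ≤ η / (1 - q₀) * ((m : ℝ) + 1) := hmain
    _ ≤ 4 / 3 * η * ((m : ℝ) + 1) := mul_le_mul_of_nonneg_right hcoef (by positivity)

/-- **LIPSCHITZ IN THE FUNCTIONAL, UNIFORMLY IN THE SCALE**: under the hypotheses of `invSq_sep_le_of_functional_close`, `|h(m) − h′(m)| ≤ (32∕3)·f·(f² + 1∕β*)·η` for ALL m —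
the asymptotic-freedom weight `h(m)²h′(m) ≤ 2f∕(1∕(4f²) + (β*∕4)m)` absorbs the linear growth of the chart separation.  Node U2's `memFlow_lipschitz_functional` with the floor
`b ≤ B` and `C_m γ < b(1−θ)` replaced by the quarter profiles (from ONE AF reference, parts 10 ∕ 13) and smallness of f. [cite: Balaban1987RG1, Thm 2 (0.31) p.259 with (0.20) p.256 and p.298] -/
theorem abs_sub_le_of_functional_close {B B' : (ℕ → ℝ) → ℝ} {Cm θ γ bs f η e : ℝ} {h h' : ℕ → ℝ}
    (hB : MemoryProfile Cm θ γ B) (hCm : 0 ≤ Cm) (hθ0 : 0 ≤ θ) (hθ1 : θ < 1) (hbs : 0 < bs) (hf : 0 < f)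
    (hη : ∀ u, SeqBox γ u → |B u - B' u| ≤ η)
    (hhs : SeqBox γ h) (hhs' : SeqBox γ h') (hhf : MemFlow B e h) (hhf' : MemFlow B' e h')
    (hPh : ∀ q : ℕ, 1 / (4 * f ^ 2) + bs / 4 * (q : ℝ) ≤ 1 / (h q) ^ 2)
    (hPh' : ∀ q : ℕ, 1 / (4 * f ^ 2) + bs / 4 * (q : ℝ) ≤ 1 / (h' q) ^ 2)
    (hs6 : Cm * (8 * f ^ 3 + 16 * f / bs) ≤ (1 - θ) ^ 2 / 4) (m : ℕ) :
    |h m - h' m| ≤ 32 / 3 * f * (f ^ 2 + 1 / bs) * η := by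
  have hη0 : 0 ≤ η := (abs_nonneg _).trans (hη h hhs)
  have hk := invSq_sep_le_of_functional_close hB hCm hθ0 hθ1 hbs hf hη hhs hhs' hhf hhf' hPh hPh' hs6 m
  have hq := (hhs m).1
  have hq' := (hhs' m).1
  have hm0 : (0 : ℝ) ≤ (m : ℝ) := Nat.cast_nonneg m
  have hP : 0 < 1 / (4 * f ^ 2) + bs / 4 * (m : ℝ) := by positivity
  have hsq : (h m) ^ 2 ≤ 1 / (1 / (4 * f ^ 2) + bs / 4 * (m : ℝ)) := by
    rw [le_one_div (pow_pos hq 2) hP]; exact hPh m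
  have henv' : h' m ≤ 2 * f := le_two_mul_of_profile hbs.le hf hq' hm0 (hPh' m)
  have hratio : 1 / (1 / (4 * f ^ 2) + bs / 4 * (m : ℝ)) * ((m : ℝ) + 1) ≤ 4 * f ^ 2 + 4 / bs := by
    rw [one_div_mul_eq_div, div_le_iff₀ hP]
    have e1 : (4 * f ^ 2 + 4 / bs) * (1 / (4 * f ^ 2) + bs / 4 * (m : ℝ)) = 1 + 1 / (bs * f ^ 2) + (f ^ 2 * bs + 1) * (m : ℝ) := by
      field_simp
    rw [e1]
    have h1 : 0 ≤ 1 / (bs * f ^ 2) := by positivity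
    have h2 : (m : ℝ) ≤ (f ^ 2 * bs + 1) * (m : ℝ) := by nlinarith [mul_nonneg (mul_nonneg (sq_nonneg f) hbs.le) hm0]
    linarith
  calc |h m - h' m| ≤ (h m) ^ 2 * h' m * |1 / (h m) ^ 2 - 1 / (h' m) ^ 2| := abs_sub_le_of_inv_sq hq hq'
    _ ≤ 1 / (1 / (4 * f ^ 2) + bs / 4 * (m : ℝ)) * (2 * f) * (4 / 3 * η * ((m : ℝ) + 1)) :=
        mul_le_mul (mul_le_mul hsq henv' hq'.le (by positivity)) hk (abs_nonneg _) (by positivity)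
    _ = 2 * f * (4 / 3 * η) * (1 / (1 / (4 * f ^ 2) + bs / 4 * (m : ℝ)) * ((m : ℝ) + 1)) := by ring
    _ ≤ 2 * f * (4 / 3 * η) * (4 * f ^ 2 + 4 / bs) := mul_le_mul_of_nonneg_left hratio (by positivity)
    _ = 32 / 3 * f * (f ^ 2 + 1 / bs) * η := by ring

/-- **node U2's `solution`s OF TWO η-CLOSE FUNCTIONALS ARE O(η)-CLOSE NEAR ZERO PIN, FLOOR-FREE.**  `B`, `B′` BOTH with memory profile `(C_m, θ)` on ]0, γ]^ℕ and EACH with ONE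
asymptotically free reference solution (t of `(B, g*)` at rate β*, t′ of `(B′, g*′)` at rate β*′, pins t_a, t_a′), `|B − B′| ≤ η` on the box, and a pin `0 < e`, `2e ≤ γ` below
both thresholds of part 13 and with `C_m(8e³ + 16e∕β₀) ≤ (1 − θ)²∕4`, β₀ = min(β*, β*′).  THEN `|solution B e m − solution B′ e m| ≤ (32∕3)·e·(e² + 1∕β₀)·η` at EVERY scale m
(part 13's `memFlow_solution_of_reference` for both, their quarter profiles weakened to the common rate β₀, then `abs_sub_le_of_functional_close` with f = e).
[cite: Balaban1987RG1, Thm 2 (0.31) p.259 with (0.20) p.256 and p.298] -/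
theorem abs_solution_sub_le_of_functional_close {B B' : (ℕ → ℝ) → ℝ} {Cm θ γ bs bs' ta ta' gs gs' η e : ℝ} {t t' : ℕ → ℝ}
    (hB : MemoryProfile Cm θ γ B) (hB' : MemoryProfile Cm θ γ B') (hCm : 0 ≤ Cm) (hθ0 : 0 ≤ θ) (hθ1 : θ < 1)
    (hbs : 0 < bs) (hta : 0 < ta) (hts : SeqBox γ t) (htf : MemFlow B gs t) (hprof : ∀ m : ℕ, 1 / ta ^ 2 + bs * (m : ℝ) ≤ 1 / (t m) ^ 2)
    (hbs' : 0 < bs') (hta' : 0 < ta') (hts' : SeqBox γ t') (htf' : MemFlow B' gs' t') (hprof' : ∀ m : ℕ, 1 / ta' ^ 2 + bs' * (m : ℝ) ≤ 1 / (t' m) ^ 2)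
    (hη : ∀ u, SeqBox γ u → |B u - B' u| ≤ η) (he : 0 < e) (h2e : 2 * e ≤ γ)
    (hs1 : 4 * Cm * e ≤ bs * (1 - θ)) (hs2 : e ^ 2 * (1 / gs ^ 2 + Cm * γ / (1 - θ) ^ 2 + (2 * Cm / ((1 - θ) * bs)) ^ 2) ≤ 3 / 4)
    (hs1' : 4 * Cm * e ≤ bs' * (1 - θ)) (hs2' : e ^ 2 * (1 / gs' ^ 2 + Cm * γ / (1 - θ) ^ 2 + (2 * Cm / ((1 - θ) * bs')) ^ 2) ≤ 3 / 4)
    (hs4 : 64 * Cm * e ^ 3 ≤ (1 - θ) ^ 2) (hs6 : Cm * (8 * e ^ 3 + 16 * e / min bs bs') ≤ (1 - θ) ^ 2 / 4) (m : ℕ) :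
    |solution B e m - solution B' e m| ≤ 32 / 3 * e * (e ^ 2 + 1 / min bs bs') * η := by
  obtain ⟨hss, hsf, hP, -⟩ := memFlow_solution_of_reference hB hCm hθ0 hθ1 hbs hta hts htf hprof he h2e hs1 hs2 hs4
  obtain ⟨hss', hsf', hP', -⟩ := memFlow_solution_of_reference hB' hCm hθ0 hθ1 hbs' hta' hts' htf' hprof' he h2e hs1' hs2' hs4
  have hb0 : 0 < min bs bs' := lt_min hbs hbs'
  have hPw : ∀ q : ℕ, 1 / (4 * e ^ 2) + min bs bs' / 4 * (q : ℝ) ≤ 1 / (solution B e q) ^ 2 := fun q =>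
    (add_le_add le_rfl (mul_le_mul_of_nonneg_right (div_le_div_of_nonneg_right (min_le_left _ _) (by norm_num)) (Nat.cast_nonneg q))).trans (hP q)
  have hPw' : ∀ q : ℕ, 1 / (4 * e ^ 2) + min bs bs' / 4 * (q : ℝ) ≤ 1 / (solution B' e q) ^ 2 := fun q =>
    (add_le_add le_rfl (mul_le_mul_of_nonneg_right (div_le_div_of_nonneg_right (min_le_right _ _) (by norm_num)) (Nat.cast_nonneg q))).trans (hP' q)
  exact abs_sub_le_of_functional_close hB hCm hθ0 hθ1 hb0 he hη hss hss' hsf hsf' hPw hPw' hs6 m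

/-! ## §20b The same kernel along ONE iteration: a scale-UNIFORM geometric rate for profiled starts -/

/-- **SCALE-UNIFORM GEOMETRIC RATE OF THE LATTICE-FREE ITERATION.**  `B` with memory profile `(C_m, θ)` and ONE AF reference (as in part 13); a pin e below part 13's threshold with,
in addition, `C_m(8e³ + 16e∕β*) ≤ (1 − θ)²∕4`; the box solution h from e (any — it is `solution B e`); a box start u₀ ≤ 2e that ALREADY carries the quarter profile from 2e and whose
chart distance to h grows at most linearly, `|1∕u₀(q)² − 1∕h(q)²| ≤ N₀(q+1)`.  THEN for all n, q: **`|((picard B e)^[n] u₀)(q) − h(q)| ≤ 8e(e² + 1∕β*)·N₀·4^{−n}`** — UNIFORM IN THE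
SCALE (part 13's `abs_picardIter_sub_solution_le` pays `(2∕(1+θ))^q`): the linear-weight kernel contracts `N ↦ q₀N`, q₀ ≤ ¼, along the iteration, and the AF weight
`u_n(q)²h(q) ≤ 2e∕(1∕(4e²) + (β*∕4)q)` absorbs the factor (q+1). [folklore] -/
theorem abs_picardIter_sub_le_uniform {B : (ℕ → ℝ) → ℝ} {Cm θ γ bs ta gs e N₀ : ℝ} {t u₀ h : ℕ → ℝ}
    (hB : MemoryProfile Cm θ γ B) (hCm : 0 ≤ Cm) (hθ0 : 0 ≤ θ) (hθ1 : θ < 1) (hbs : 0 < bs) (hta : 0 < ta)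
    (hts : SeqBox γ t) (htf : MemFlow B gs t) (hprof : ∀ m : ℕ, 1 / ta ^ 2 + bs * (m : ℝ) ≤ 1 / (t m) ^ 2)
    (he : 0 < e) (h2e : 2 * e ≤ γ) (hus : SeqBox γ u₀) (henv : ∀ q, u₀ q ≤ 2 * e)
    (hPu : ∀ q : ℕ, 1 / (4 * e ^ 2) + bs / 4 * (q : ℝ) ≤ 1 / (u₀ q) ^ 2)
    (hs1 : 4 * Cm * e ≤ bs * (1 - θ))
    (hs2 : e ^ 2 * (1 / gs ^ 2 + Cm * γ / (1 - θ) ^ 2 + (2 * Cm / ((1 - θ) * bs)) ^ 2) ≤ 3 / 4)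
    (hs6 : Cm * (8 * e ^ 3 + 16 * e / bs) ≤ (1 - θ) ^ 2 / 4)
    (hhs : SeqBox γ h) (hhf : MemFlow B e h) (hPh : ∀ q : ℕ, 1 / (4 * e ^ 2) + bs / 4 * (q : ℝ) ≤ 1 / (h q) ^ 2)
    (hN0 : ∀ q : ℕ, |1 / (u₀ q) ^ 2 - 1 / (h q) ^ 2| ≤ N₀ * ((q : ℝ) + 1)) (n q : ℕ) :
    |(picard B e)^[n] u₀ q - h q| ≤ 8 * e * (e ^ 2 + 1 / bs) * N₀ * (1 / 4) ^ n := by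
  have h1θ : 0 < 1 - θ := by linarith
  have hmem := picardIter_mem hB hCm hθ0 hθ1 hbs hta hts htf hprof he h2e hus henv hs1 hs2
  have hprofit := picardIter_profile hB hCm hθ0 hθ1 hbs hta hts htf hprof he h2e hus henv hs1 hs2
  have hinv := invSq_picardIter_succ hB hCm hθ0 hθ1 hbs hta hts htf hprof he h2e hus henv hs1 hs2
  set q₀ : ℝ := Cm / (1 - θ) ^ 2 * (8 * e ^ 3 + 16 * e / bs) with hq₀
  have hq00 : 0 ≤ q₀ := by positivity
  have hq01 : q₀ ≤ 1 / 4 := by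
    rw [hq₀, div_mul_eq_mul_div, div_le_iff₀ (by positivity)]; linarith
  have hN00 : 0 ≤ N₀ := by
    have h0 := hN0 0
    simp only [Nat.cast_zero, zero_add, mul_one] at h0
    exact (abs_nonneg _).trans h0
  -- every iterate carries the quarter profile from 2e
  have hP : ∀ k q : ℕ, 1 / (4 * e ^ 2) + bs / 4 * (q : ℝ) ≤ 1 / ((picard B e)^[k] u₀ q) ^ 2 := by
    intro k q
    rcases k with _ | k
    · exact hPu q
    · exact hprofit k q
  -- the chart separation to h contracts by q₀ per step, with the linear weight
  have hN : ∀ k q : ℕ, |1 / ((picard B e)^[k] u₀ q) ^ 2 - 1 / (h q) ^ 2| ≤ q₀ ^ k * N₀ * ((q : ℝ) + 1) := by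
    intro k
    induction k with
    | zero => intro q; simpa using hN0 q
    | succ k ih =>
      intro q
      rw [hinv k q, invSq_eq_of_memFlow hhf q, add_sub_add_left_eq_sub]
      have hk := abs_drive_sub_drive_le_linear hB hCm hθ0 hθ1 hbs he (hmem k).1 hhs (hP k) hPh ih q
      calc |drive B ((picard B e)^[k] u₀) q - drive B h q| ≤ q₀ * (q₀ ^ k * N₀) * ((q : ℝ) + 1) := hk
        _ = q₀ ^ (k + 1) * N₀ * ((q : ℝ) + 1) := by rw [pow_succ]; ring
  -- back to the couplings through the AF weight
  have hx := ((hmem n).1 q).1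
  have hq := (hhs q).1
  have hm0 : (0 : ℝ) ≤ (q : ℝ) := Nat.cast_nonneg q
  have hPq : 0 < 1 / (4 * e ^ 2) + bs / 4 * (q : ℝ) := by positivity
  have hsq : ((picard B e)^[n] u₀ q) ^ 2 ≤ 1 / (1 / (4 * e ^ 2) + bs / 4 * (q : ℝ)) := by
    rw [le_one_div (pow_pos hx 2) hPq]; exact hP n q
  have henvh : h q ≤ 2 * e := le_two_mul_of_profile hbs.le he hq hm0 (hPh q)
  have hratio : 1 / (1 / (4 * e ^ 2) + bs / 4 * (q : ℝ)) * ((q : ℝ) + 1) ≤ 4 * e ^ 2 + 4 / bs := by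
    rw [one_div_mul_eq_div, div_le_iff₀ hPq]
    have e1 : (4 * e ^ 2 + 4 / bs) * (1 / (4 * e ^ 2) + bs / 4 * (q : ℝ)) = 1 + 1 / (bs * e ^ 2) + (e ^ 2 * bs + 1) * (q : ℝ) := by
      field_simp
    rw [e1]
    have h1 : 0 ≤ 1 / (bs * e ^ 2) := by positivity
    have h2 : (q : ℝ) ≤ (e ^ 2 * bs + 1) * (q : ℝ) := by nlinarith [mul_nonneg (mul_nonneg (sq_nonneg e) hbs.le) hm0]
    linarith
  have hpow : q₀ ^ n ≤ (1 / 4) ^ n := pow_le_pow_left₀ hq00 hq01 n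
  calc |(picard B e)^[n] u₀ q - h q|
      ≤ ((picard B e)^[n] u₀ q) ^ 2 * h q * |1 / ((picard B e)^[n] u₀ q) ^ 2 - 1 / (h q) ^ 2| := abs_sub_le_of_inv_sq hx hq
    _ ≤ 1 / (1 / (4 * e ^ 2) + bs / 4 * (q : ℝ)) * (2 * e) * (q₀ ^ n * N₀ * ((q : ℝ) + 1)) :=
        mul_le_mul (mul_le_mul hsq henvh hq.le (by positivity)) (hN n q) (abs_nonneg _) (by positivity)
    _ = 2 * e * N₀ * q₀ ^ n * (1 / (1 / (4 * e ^ 2) + bs / 4 * (q : ℝ)) * ((q : ℝ) + 1)) := by ring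
    _ ≤ 2 * e * N₀ * q₀ ^ n * (4 * e ^ 2 + 4 / bs) := mul_le_mul_of_nonneg_left hratio (by positivity)
    _ ≤ 2 * e * N₀ * (1 / 4) ^ n * (4 * e ^ 2 + 4 / bs) := by
        have : 0 ≤ 2 * e * N₀ := by positivity
        have h4 : 0 ≤ 4 * e ^ 2 + 4 / bs := by positivity
        nlinarith [mul_le_mul_of_nonneg_left hpow this]
    _ = 8 * e * (e ^ 2 + 1 / bs) * N₀ * (1 / 4) ^ n := by ring

end

end Summit.QuantumFields.BalabanUV.Beta.EriceFlowEnclosureB12AsPrintedHistoryContagionShiftFlowPicardFunctional
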